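import Literature.AlgebraicGeometry.Motives.PoincareUniversal.GraphCondition
import HarnessLib

/-!
# On complex points the seesaw graph is a graph (M13, node N2b)

Layer `Literature/AlgebraicGeometry/Motives` ∩ `AbelianVarieties`, namespace `Literature.AlgebraicGeometry.Motives.AbelianVariety`.
THEOREMS ONLY; no definition, no named fact, no instance, no `sorry` (cell `hodgecm-mathlib`, D-0151, programme M13 node N2b =
SPEC stub `stub_M13_2_graphCond_injective_points`; HOME bytes `B-plan/m13-glue/N2b-GraphCondInjectivePoints.v2.B-p12g12.lean`).

**`graphCond_injective_points`** ([MumfordAV1970] §8 Thm. 1 p. 77 and §13 p. 125; [MilneAV2008] I §8): if two `ℂ`-points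
`(x, y)`, `(x, y')` of `T × Â` with the same `T`-coordinate both satisfy the graph condition «`(1 × y)^*𝒫 ≅ (1 × x)^*ℒ` on
`A₀ × Spec ℂ`», then `y = y'`: both slices `𝒫|_{A₀ × {y}}`, `𝒫|_{A₀ × {y'}}` are isomorphic to `s₀^*(restrictAlong x)^*ℒ`
along the slice `s₀ : A₀ ≅ A₀ × Spec ℂ`, hence to each other, so their classes agree (★ `detClass_eq_of_iso`) and Mumford's
injectivity `b ↦ [𝒫|_{A × {b}}]` on `Â(ℂ)` (★ `AbelianVarieties.eq_of_detClass_pullback_sliceAt_eq`) concludes.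
HC_CM is proved only modulo the 7 printed citations until rung 0 closes.

## References
* [MumfordAV1970] D. Mumford, *Abelian Varieties* (1970), §8 Thm. 1 (p. 77), §13 (p. 125).
* [MilneAV2008] J. S. Milne, *Abelian Varieties* (2008), I §8 (pp. 36–37).
* [GortzWedhorn2020] U. Görtz, T. Wedhorn, *Algebraic Geometry I* (2nd ed.), §(4.8) Def. 4.25 (p. 108) (fibres `X × {t}`).
-/

noncomputable section

open CategoryTheory CategoryTheory.Limits AlgebraicGeometry MonoidalCategory CartesianMonoidalCategory

namespace Literature.AlgebraicGeometry.Motives.AbelianVariety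

open Literature.AlgebraicGeometry.AbelianSchemes Literature.AlgebraicGeometry.AbelianVarieties
  Literature.AlgebraicGeometry.Modules

section N2b

variable (A₀ : AbelianVariety ℂ) {Θ : CartierDivisor A₀.X.left} (hΘ : Θ.IsAmple)
  (P : (A₀.X ⊗ (A₀.dualOf Θ hΘ).X).left.Modules)
  (T' : SchemeOver ℂ) (ℒ : (AbelianSchemeOver.ofAbelianVariety A₀).RigidifiedLineBundle T'.hom)

/-- The slice of `A₀ × B` at a `ℂ`-point `z` factors through the slice `A₀ ≅ A₀ × Spec ℂ`:
`(𝟙, z) = (𝟙, pt) ≫ (A₀ ◁ z)`. [cite: GortzWedhorn2020, §(4.8) Def. 4.25 (p. 108) (the fibre X × {t})] -/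
theorem lift_id_toSpecOver_comp_eq_comp_whiskerLeft {B : SchemeOver ℂ} (z : AlgPoints B ℂ) :
    CartesianMonoidalCategory.lift (𝟙 A₀.X) (toSpecOver A₀.X ≫ z) =
      CartesianMonoidalCategory.lift (𝟙 A₀.X) (toSpecOver A₀.X) ≫ A₀.X ◁ z := by
  apply CartesianMonoidalCategory.hom_ext
  · rw [CartesianMonoidalCategory.lift_fst, Category.assoc, whiskerLeft_fst, CartesianMonoidalCategory.lift_fst]
  · rw [CartesianMonoidalCategory.lift_snd, Category.assoc, whiskerLeft_snd,
      CartesianMonoidalCategory.lift_snd_assoc]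

/-- **The graph condition at a `ℂ`-point, read on the slice `A₀ ≅ A₀ × Spec ℂ`**: `GraphCond (x, z)` gives
`𝒫|_{A₀ × {z}} ≅ s₀^* (restrictAlong (x, z))^* ℒ` with `s₀ = (𝟙, pt) : A₀ → A₀ × Spec ℂ` (★ `Scheme.Modules.pullbackComp`,
★ `baseChangeToProd_ofAbelianVariety_eq_whiskerLeft_left`). [cite: MumfordAV1970, §13 (proof of the Thm. p. 125)] -/
theorem nonempty_sliceAt_iso_of_graphCond (x : AlgPoints T' ℂ) (z : AlgPoints (A₀.dualOf Θ hΘ).X ℂ)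
    (hz : GraphCond A₀ hΘ P T' ℒ (CartesianMonoidalCategory.lift x z)) :
    Nonempty ((Scheme.Modules.pullback (CartesianMonoidalCategory.lift (𝟙 A₀.X) (toSpecOver A₀.X ≫ z)).left).obj P ≅
      (Scheme.Modules.pullback (CartesianMonoidalCategory.lift (𝟙 A₀.X) (toSpecOver A₀.X)).left).obj
        ((Scheme.Modules.pullback (restrictAlong A₀ hΘ T' (CartesianMonoidalCategory.lift x z))).obj ℒ.L)) := by
  obtain ⟨φ⟩ := hz
  have hbc : (AbelianSchemeOver.ofAbelianVariety A₀).baseChangeToProd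
      (AbelianSchemeOver.ofAbelianVariety (A₀.dualOf Θ hΘ)) (specOver ℂ ℂ).hom
      (CartesianMonoidalCategory.lift x z ≫ CartesianMonoidalCategory.snd _ _).left
      (Over.w (CartesianMonoidalCategory.lift x z ≫ CartesianMonoidalCategory.snd _ _)) = (A₀.X ◁ z).left := by
    rw [AbelianSchemeOver.baseChangeToProd_ofAbelianVariety_eq_whiskerLeft_left A₀ (A₀.dualOf Θ hΘ)
      (CartesianMonoidalCategory.lift x z ≫ CartesianMonoidalCategory.snd _ _), CartesianMonoidalCategory.lift_snd]
  have e : (CartesianMonoidalCategory.lift (𝟙 A₀.X) (toSpecOver A₀.X ≫ z)).left =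
      (CartesianMonoidalCategory.lift (𝟙 A₀.X) (toSpecOver A₀.X)).left ≫ (A₀.X ◁ z).left := by
    rw [← Over.comp_left, ← lift_id_toSpecOver_comp_eq_comp_whiskerLeft]
  refine ⟨eqToIso (congrArg (fun k => (Scheme.Modules.pullback k).obj P) e) ≪≫
    ((Scheme.Modules.pullbackComp _ _).app P).symm ≪≫
    (Scheme.Modules.pullback _).mapIso
      (eqToIso (congrArg (fun k => (Scheme.Modules.pullback k).obj P) hbc).symm ≪≫ φ)⟩

/-- **ON `ℂ`-POINTS THE SEESAW GRAPH IS A GRAPH** (M13 SPEC stub `stub_M13_2_graphCond_injective_points`, v0.4 signature).  Two `ℂ`-points `(x, y)`, `(x, y')` of `T × Â` with the same `T`-coordinate and the graph condition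
have `y = y'`: both slices `𝒫|_{A₀ × {y}}`, `𝒫|_{A₀ × {y'}}` are isomorphic to `s₀^* (restrictAlong x)^* ℒ`
(`restrictAlong (x, y) = restrictAlong (x, y')`), hence to each other, so their classes in `Ȟ¹(A₀, 𝒪^×)` agree
(★ `detClass_eq_of_iso`) and Mumford §8 Thm. 1 injectivity on `Â(ℂ)` (★ `eq_of_detClass_pullback_sliceAt_eq`) concludes.
[cite: MumfordAV1970, §8 Thm. 1 (p. 77) and §13 (p. 125)] [cite: MilneAV2008, I §8 (pp. 36–37)] -/
theorem graphCond_injective_points (hP1 : HasRank P 1)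
    (eP : Nonempty ((Scheme.Modules.pullback (AbelianVariety.Hom.toSchemeHom (A₀.oneProdPhiTheta hΘ))).obj P ≅
      mumfordSheaf A₀ Θ))
    (x : AlgPoints T' ℂ) (y y' : AlgPoints (A₀.dualOf Θ hΘ).X ℂ)
    (hy : GraphCond A₀ hΘ P T' ℒ (CartesianMonoidalCategory.lift x y))
    (hy' : GraphCond A₀ hΘ P T' ℒ (CartesianMonoidalCategory.lift x y')) : y = y' := by
  have hPff := HasRank.isFiniteLocallyFree' hP1
  obtain ⟨ψ⟩ := nonempty_sliceAt_iso_of_graphCond A₀ hΘ P T' ℒ x y hy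
  obtain ⟨ψ'⟩ := nonempty_sliceAt_iso_of_graphCond A₀ hΘ P T' ℒ x y' hy'
  have e := congrArg (fun k => (Scheme.Modules.pullback
      (CartesianMonoidalCategory.lift (𝟙 A₀.X) (toSpecOver A₀.X)).left).obj ((Scheme.Modules.pullback k).obj ℒ.L))
    (restrictAlong_lift_eq A₀ hΘ T' x y y')
  exact eq_of_detClass_pullback_sliceAt_eq A₀ hΘ hP1 eP y y'
    (detClass_eq_of_iso (ψ ≪≫ eqToIso e ≪≫ ψ'.symm) (hPff.pullback _) (hPff.pullback _))

end N2b

end Literature.AlgebraicGeometry.Motives.AbelianVariety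

end
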